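/-
Copyright: cell pub-balaban-gaps (YM BLITZ Y1, track G1), seat g1-p2 GEN 4 (unit `pub-balaban-gaps-g1-p2`).  Row (D4) NODE O,
OBJECT ∕ MECHANISM level: the GLUING step [B9] (3.87)–(3.90) of Theorem 3.7 ∕ 3.10 at ONE scale in the NODE-O currency — the
glued inverse `G′ = S·(1 − R)⁻¹` (seed family `S = Σ_□ h_□G′_□h_□`, step family `R = Σ_□ K(h_□)G′_□h_□`, identity (3.88)
`Δ′S = 1 − R`) is a `JointWalkExpansion` when `S` and `R` are, by this seat's product (p353639 ✓) and Neumann (INTENT-19) steps.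
HONEST FRAMING: bookkeeping over landed hypothesis SHAPES; nothing of Bałaban's constructed or asserted; (D4) NOT discharged
(instance 0∕1); NOT BetaPertH, NOT continuum, NOT Clay.
-/
import Summits.QuantumFields.BalabanUV.Gaps.D4WalkNeumann

/-!
# `Gaps.D4WalkGlue` — (3.87)–(3.90): the glued inverse `S·(1 − R)⁻¹` is a joint walk expansion (cell pub-balaban-gaps, seat g1-p2 gen 4)

HONEST DEPENDENCY (cell pub-balaban, verbatim): continuum YM on T⁴ ⇐ BetaPertH ∧ nine spine estimates (0/9 proved);
BetaPertH ⇐ (D1) ∧ (D4) ∧ CAP+tail.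

[B9] p. 409 (3.87)–(3.90): with a partition of unity `{h_□}` and local inverses `G′_□`, `S := Σ_□ h_□G′_□h_□` satisfies
`Δ′S = I − R`, `R := Σ_□ K(h_□)G′_□h_□` ((3.88)), hence `G′ = S(I − R)⁻¹ = Σ_n S Rⁿ` ((3.89)–(3.90)) and *"This theorem follows
simply from Corollary 3.6 holding for all G′_□, □ ∈ 𝒟, from the bound (3.89) and Lemma 2.1"* (p. 410); Thm 3.10 p. 416 is the
resulting walk expansion (3.107)–(3.108).  In the NODE-O currency of row (D4) the two families `S`, `R` are one-step
DOMAIN-LOCALISED operator families (`B13DomainKernelWalks`, INTENT-21; or site-pair local, `B13LocalKernelWalks`) — hence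
`JointWalkExpansion`s with torus-uniform constants — and THIS FILE records the two-line composition: `(1 − R)⁻¹` by
`D4WalkNeumann.jointWalkExpansion_inv_pencil` at `t = −1` with the identity seed, then `S·(1 − R)⁻¹` by
`D4WalkProduct.jointWalkExpansion_mul`; and the algebra `Δ′·(S(1 − R)⁻¹) = 1` from (3.88), so the glued family IS the inverse
of `Δ′` on polydisc × ball.  Every hypothesis is a SHAPE or a rate inequality; nothing of Bałaban's (his `Δ′`, `G′_□`, `h_□`,
their k-dependence) is constructed.  Value: kernel-checked bookkeeping; words of row (D4) UNCHANGED.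
-/

noncomputable section

namespace Summit.QuantumFields.BalabanUV.Gaps.D4WalkGlue

open Metric Set Finset
open Literature.MathematicalPhysics.QuantumFieldTheory.Balaban1983to89
open Literature.MathematicalPhysics.QuantumFieldTheory.Balaban1983to89.B9SectDWalk (Through MajSumLe DomBy infConv chainConst chainDist)
open Literature.MathematicalPhysics.QuantumFieldTheory.Balaban1983to89.B9Thm34Ext (toB6)
open Literature.MathematicalPhysics.QuantumFieldTheory.Balaban1983to89.B9Thm37GlueTorus (torusGeom tdist1 tdist1_nonneg tdist1_self)
open Literature.MathematicalPhysics.QuantumFieldTheory.Balaban1983to89.TreeLengthTorus (TPt)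
open Literature.MathematicalPhysics.QuantumFieldTheory.Balaban1983to89.B5TorusCover (UT)
open Literature.MathematicalPhysics.QuantumFieldTheory.Balaban1983to89.B11SectG (RowSum)
open Literature.MathematicalPhysics.QuantumFieldTheory.Balaban1983to89.B13JointWalkExpansion (JointWalkExpansion)
open Summit.QuantumFields.BalabanUV.Gaps.D4WalkProduct (jointWalkExpansion_mul domBy_infConv_torus)
open Summit.QuantumFields.BalabanUV.Gaps.D4WalkNeumann (jointWalkExpansion_inv_pencil domBy_chain)

variable {ν : ℕ} {Nf : Fin ν → ℕ} [∀ i, NeZero (Nf i)]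
variable {d N' : ℕ} {p n : Type} [Fintype n] [DecidableEq n]
variable {E : Type*} [NormedAddCommGroup E] [NormedSpace ℂ E]

/-! ## §1. The identity seed and the algebra of (3.88) -/

/-- One-term majorant families on `Unit`. -/
private theorem majSumLe_unit {g : B6.Geometry} {K Kbar : g.Site → g.Site → ℝ} (hK : ∀ a b, 0 ≤ K a b)
    (hle : ∀ a b, K a b ≤ Kbar a b) : MajSumLe (fun (_ : Unit) a b => K a b) Kbar := by
  intro S a b
  calc ∑ _ω ∈ S, K a b ≤ ∑ _ω ∈ (Finset.univ : Finset Unit), K a b :=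
        Finset.sum_le_sum_of_subset_of_nonneg (Finset.subset_univ S) fun _ _ _ => hK a b
    _ = K a b := by simp
    _ ≤ Kbar a b := hle a b

omit [Fintype n] in
/-- The identity family is a one-term joint walk expansion at walk rate `κ + ε`, window `ε`, torus rate `κ`, constant `1`, walk
distance `d₁`, no σ-carrying term (the seed of the Neumann step for `(1 − R)⁻¹`). -/
theorem jointWalkExpansion_one (c₀ : B13.Consts) (locn : n → UT Nf) (X : Finset (UT Nf)) (R ε κ : ℝ) :
    JointWalkExpansion c₀ locn locn (fun (_ : TPt d N' → ℂ) (_ : E) => (1 : Matrix n n ℂ)) X R ε κ 1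
      (fun (_ : Unit) (_ : TPt d N' → ℂ) (_ : E) => (1 : Matrix n n ℂ)) (∅ : Set Unit) (fun _ => 1)
      (fun _ => tdist1 Nf) (κ + ε) where
  hasSum σ _ u _ i j := hasSum_unique (fun _ : Unit => (1 : Matrix n n ℂ) i j)
  termAnalytic _ σ _ i j := differentiableOn_const _
  maj _ σ _ u _ i j := by
    by_cases h : i = j
    · subst h; simp [tdist1_self]
    · rw [Matrix.one_apply_ne h, norm_zero]; positivity
  majSum := majSumLe_unit (fun a b => by positivity) (fun a b => by simp)
  indep _ _ σ _ := rfl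
  through ω hω := by simp at hω
  A_nonneg _ := zero_le_one
  D_nonneg _ a b := tdist1_nonneg a b

omit [∀ i, NeZero (Nf i)] [NormedSpace ℂ E] in
/-- **(3.88) ⟹ (3.89), the algebra**: if `Δ·S = 1 − R` and `X·(1 − R) = 1 = (1 − R)·X` (i.e. `X = (1 − R)⁻¹` on the finite index),
then `Δ·(S·X) = 1`. -/
theorem delta_mul_glue_eq_one {Δ S R X : Matrix n n ℂ} (h388 : Δ * S = 1 - R) (hX : (1 - R) * X = 1) : Δ * (S * X) = 1 := by
  rw [← Matrix.mul_assoc, h388, hX]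

/-! ## §2. The glued inverse is a joint walk expansion -/

variable {c₀ : B13.Consts} {locp : p → UT Nf} {locn : n → UT Nf} {X : Finset (UT Nf)}
variable {S : (TPt d N' → ℂ) → E → Matrix p n ℂ} {Rm : (TPt d N' → ℂ) → E → Matrix n n ℂ}
variable {WS WR : Type} {TS : WS → (TPt d N' → ℂ) → E → Matrix p n ℂ} {TR : WR → (TPt d N' → ℂ) → E → Matrix n n ℂ}
variable {SXS : Set WS} {SXR : Set WR} {AS : WS → ℝ} {AR : WR → ℝ}
variable {DS : WS → UT Nf → UT Nf → ℝ} {DR : WR → UT Nf → UT Nf → ℝ}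
variable {R ρS εS κS KbarS ρR εR κR KbarR ρ ε ρs σ₁ c₁ σ' c' κs κ ρ' ε' κ' : ℝ} {m : ℕ}

/-- **THE GLUED INVERSE `S·(1 − R)⁻¹` IS A JOINT WALK EXPANSION** ([B9] (3.87)–(3.90), Thm 3.7 ∕ 3.10 at one scale, NODE-O
currency).  Data: joint walk expansions of the seed family `S` (`p × n`; rates `ρ_S, ε_S, κ_S`, constant `K̄_S`) and of the step
family `R` (`n × n`; `ρ_R, ε_R, κ_R, K̄_R`), same σ-region and ball, walk distances dominating `d₁`, fibre `m` of `locn`, row sums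
`(σ₁, c₁)` and `(σ′, c′)`.  STEP 1 (Neumann, `t = −1`, identity seed): chain rate `ρ` with window `ε`, `0 ≤ ε ≤ ρ`, `ρ + σ₁ ≤ ρ_s`,
`ρ_s + σ₁ ≤ ρ_R`, `ρ_R − ε_R ≤ ρ − ε`, torus rates `κ + σ′ ≤ κ_s ≤ κ_R`, `κ_s + σ′ ≤ ρ − ε`, `κ ≤ ρ − ε`, margin
`q = (mc₁)((mc₁)·1·(1·K̄_R)c′)c′ < 1` ⟹ `(1 − R)⁻¹` is a joint walk expansion at `(ρ, ε, κ, (1 − q)⁻¹)`.  STEP 2 (product, the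
seed pays): `ρ′ + σ₁ ≤ ρ_S`, `ρ′ ≤ ρ`, `ρ_S − ε_S ≤ ρ′ − ε′`, `ρ − ε ≤ ρ′ − ε′`, `0 ≤ ε′`, `κ′ ≤ κ`, `κ′ + σ′ ≤ κ_S` ⟹
`S·(1 − R)⁻¹` is a joint walk expansion at `(ρ′, ε′, κ′)` with constant `(mc₁)·K̄_S·(1·(1 − q)⁻¹)·c′` (terms ∕ σ-carrying set ∕
amplitudes ∕ distances ∃-packaged, as `TermWalkData` consumes them; the distances dominate `d₁`, so the family can be multiplied
∕ inverted again).  Composition BY NAME of `D4WalkNeumann.jointWalkExpansion_inv_pencil` and `D4WalkProduct.jointWalkExpansion_mul`. -/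
theorem jointWalkExpansion_glue
    (hS : JointWalkExpansion c₀ locp locn S X R εS κS KbarS TS SXS AS DS ρS)
    (hR : JointWalkExpansion c₀ locn locn Rm X R εR κR KbarR TR SXR AR DR ρR)
    (hSdom : ∀ ω, DomBy (toB6 (torusGeom Nf 0 0 0) 0 True) (DS ω))
    (hRdom : ∀ ω, DomBy (toB6 (torusGeom Nf 0 0 0) 0 True) (DR ω))
    (hfib : ∀ y : UT Nf, (Finset.univ.filter fun k => locn k = y).card ≤ m)
    (hrow : RowSum (toB6 (torusGeom Nf 0 0 0) 0 True) σ₁ c₁) (hrow' : RowSum (toB6 (torusGeom Nf 0 0 0) 0 True) σ' c')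
    (hσ₁ : 0 ≤ σ₁) (hσ' : 0 ≤ σ') (hc₁ : 0 ≤ c₁) (hc' : 0 ≤ c')
    -- step 1: the Neumann window
    (hε : 0 ≤ ε) (hερ : ε ≤ ρ) (hρs : ρ + σ₁ ≤ ρs) (hρsR : ρs + σ₁ ≤ ρR) (hwR : ρR - εR ≤ ρ - ε)
    (hKR : 0 ≤ KbarR) (hκs : 0 ≤ κs) (hκsR : κs ≤ κR) (hκsC : κs + σ' ≤ ρ - ε) (hκ : 0 ≤ κ) (hκC : κ ≤ ρ - ε)
    (hκκs : κ + σ' ≤ κs)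
    (hq : (m * c₁) * ((m * c₁) * 1 * (1 * KbarR) * c') * c' < 1)
    -- step 2: the product window (seed pays)
    (hρ' : 0 ≤ ρ') (hρ'ρ : ρ' ≤ ρ) (hρ'S : ρ' + σ₁ ≤ ρS) (hε' : 0 ≤ ε') (hwS : ρS - εS ≤ ρ' - ε') (hw1 : ρ - ε ≤ ρ' - ε')
    (hKS : 0 ≤ KbarS) (hκ' : 0 ≤ κ') (hκ'κ : κ' ≤ κ) (hκ'S : κ' + σ' ≤ κS) :
    ∃ (W : Type) (T : W → (TPt d N' → ℂ) → E → Matrix p n ℂ) (SX : Set W) (A : W → ℝ) (D : W → UT Nf → UT Nf → ℝ)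
      (ρ₀ : ℝ), JointWalkExpansion c₀ locp locn (fun σ₀ u => S σ₀ u * ((1 : Matrix n n ℂ) + (-1 : ℂ) • Rm σ₀ u)⁻¹) X R ε' κ'
        ((m * c₁) * KbarS * (1 * (1 - (m * c₁) * ((m * c₁) * 1 * (1 * KbarR) * c') * c')⁻¹) * c') T SX A D ρ₀ ∧
      ∀ ω, DomBy (toB6 (torusGeom Nf 0 0 0) 0 True) (D ω) := by
  -- step 1: (1 − R)⁻¹ = (1 + (−1)•R)⁻¹ by the Neumann step with the identity seed
  have hone := jointWalkExpansion_one (d := d) (N' := N') (E := E) c₀ locn X R (ρs - (ρ - ε)) (ρ - ε)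
  have hinv := jointWalkExpansion_inv_pencil (A := fun (_ : TPt d N' → ℂ) (_ : E) => (1 : Matrix n n ℂ))
    (t := (-1 : ℂ)) (τ := 1) (ρ := ρ) (ε := ε) (ρs := ρs) (κs := κs) (κ := κ)
    hone hR (fun _ a b => le_rfl) hRdom (fun σ₀ _ u _ => Matrix.one_mul _) hfib hrow hrow' hσ₁ hσ' hc₁ hc'
    hε hερ hρs (by linarith) hρsR (by linarith) hwR zero_le_one hKR hκs hκsR hκsC hκ hκC hκκs zero_le_one (by simp) hq
  -- step 2: S · (1 − R)⁻¹, the seed pays the middle row sum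
  have hq1 : 0 < 1 - (m * c₁) * ((m * c₁) * 1 * (1 * KbarR) * c') * c' := by linarith
  have hCdom : ∀ ω : List (Unit × WR) × Unit, DomBy (toB6 (torusGeom Nf 0 0 0) 0 True)
      (chainDist (g := toB6 (torusGeom Nf 0 0 0) 0 True)
        (fun i : Unit × WR => infConv (g := toB6 (torusGeom Nf 0 0 0) 0 True) (tdist1 Nf) (DR i.2)) (tdist1 Nf) ω.1) :=
    fun ω => domBy_chain (DC := fun _ : Unit => tdist1 Nf) (fun _ a b => le_rfl) hRdom ω
  have hmul := jointWalkExpansion_mul (ρ := ρ') (ε := ε') (κ := κ') hS hinv hSdom hCdom hfib hrow hrow' hρ' hρ'ρ hσ₁ hρ'S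
    hε' hwS hw1 hKS (by positivity) hκ' hκ'κ hκ'S hc₁
  exact ⟨_, _, _, _, _, _, hmul, fun ω => domBy_infConv_torus (hSdom ω.1) (hCdom ω.2)⟩

omit [∀ i, NeZero (Nf i)] [NormedAddCommGroup E] [NormedSpace ℂ E] in
/-- **… and it IS the inverse of `Δ′`**: under (3.88) `Δ′(σ,u)·S(σ,u) = 1 − R(σ,u)` and invertibility of `1 − R(σ,u)` (which the
Neumann step provides entrywise), `Δ′·(S(1 − R)⁻¹) = 1` at every `(σ,u)`. -/
theorem delta_mul_glue {Δ : (TPt d N' → ℂ) → E → Matrix n n ℂ} {S Rm : (TPt d N' → ℂ) → E → Matrix n n ℂ}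
    (σ₀ : TPt d N' → ℂ) (u : E) (h388 : Δ σ₀ u * S σ₀ u = 1 - Rm σ₀ u) (hunit : IsUnit (1 - Rm σ₀ u).det) :
    Δ σ₀ u * (S σ₀ u * ((1 : Matrix n n ℂ) + (-1 : ℂ) • Rm σ₀ u)⁻¹) = 1 := by
  have e : (1 : Matrix n n ℂ) + (-1 : ℂ) • Rm σ₀ u = 1 - Rm σ₀ u := by rw [neg_one_smul, sub_eq_add_neg]
  rw [e]
  exact delta_mul_glue_eq_one h388 (Matrix.mul_nonsing_inv _ hunit)

end Summit.QuantumFields.BalabanUV.Gaps.D4WalkGlue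

end
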